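import Literature.Barriers.AtomisticToContinuum.DisorderedHarmonicChain
import Literature.MathematicalPhysics.KineticTheory.HarmonicChainCovariance
import Mathlib.MeasureTheory.Constructions.Pi
import Mathlib.MeasureTheory.Integral.Bochner.Basic
import HarnessLib

/-!
# The Casher–Lebowitz chain: Lyapunov covariance, transmission integral, and the reduction of Ajanki–Huveneers 2011 Thm 1.1

Companion to `DisorderedHarmonicChain.lean` (barrier catalogue
`Literature/Barriers/AtomisticToContinuum/`, sub-problem `FouriersLaw`), which vendors the named
fact `Literature.Barriers.AtomisticToContinuum.AjankiHuveneers2011_scaling` (Ajanki–Huveneers,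
*Rigorous scaling law for the heat current in disordered harmonic chain*, CMP **301** (2011),
arXiv:1003.1076, Theorem 1.1) on the tree's SDE side: weak steady states `clIsSteadyState` of the
generator `clGenerator` and the left-bath power `clLeftFlux`.

The printed theorem is an XL theory and its proof never touches the SDE: it STARTS from the
Casher–Lebowitz transmission formula for the stationary current of the chain with FIXED masses,
"`J^{(μ)}_n = (T_1 - T_n) ∫_ℝ |v_{μ,n}ᵀ A_n(w)⋯A_1(w) v_{μ,1}|^{-2} dw`" [AH2011 (1.2)], where the
`A_k` are the transfer matrices and, for the Casher–Lebowitz baths, "`v_{CL,1}(w) =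
(αM_1w)^{-1/2} e_1 + i(αM_1w)^{1/2} e_2`, `v_{CL,n}(w) = (αM_nw)^{-1/2} e_1 - i(αM_nw)^{1/2} e_2`"
[AH2011 (2.5), "in [Casher-Lebowitz-71] it was proven that …"], the matrix elements `D_n(e_k)`
being "certain real valued (sub-)determinants of a semi-infinite matrix" [AH2011 §2.1]; and then
proves `E ∫ … ≍ n^{-3/2}` (§§3–6, with O'Connor 1975 for the high frequencies). This file makes
that structure formal and sorry-free:

* the linear-algebra side of the model (all PROVED): the Dirichlet force matrix `clForceMatrix`
  (Hessian of the potential of `clHamiltonian`: free Laplacian plus the two wall springs, which sit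
  at the bath sites), the drift and noise matrices `clDriftMatrix m λ = [[0, M⁻¹], [-Φ_D, -λE]]`,
  `clNoiseMatrix = [[0,0],[0, diag(2λ m_i T_i)]]` of the SDE of [AH2011 §1.1] in the form
  `q̇ = -a q + η` of [Dhar2008 §3.1], `isHurwitz_clDriftMatrix` (energy dissipation + propagation
  along the chain, as for `isHurwitz_driftMatrix` in `HarmonicChainCovariance.lean`), hence THE
  stationary covariance `clCov m λ T_L T_R := lyapSol …` with its Lyapunov equation
  `clCov_lyapunov` and uniqueness `eq_clCov` ("`a·B + B·aᵀ = D` … completely determines the steady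
  state since we are dealing with a Gaussian process" [Dhar2008 §3.1], arbitrary masses);
* the frequency side: the impedance matrix `clImpedance m λ ω = Φ_D - ω²M - iωλ M E`
  (`Ẑ = -ω²M̂ + Φ̂ - Σ̂(ω)`, `Σ_{11} = Σ_{NN} = iγω` [Dhar2008 §3.4.1], here `γ_l = λ m_l`) and the
  transmission integral per unit temperature difference
  `clSpectralConductance m λ = (λ² m_1 m_n/π) ∫_ℝ ω² |det Z_n(ω)|^{-2} dω`
  (`J = ΔT/(4π) ∫ 𝒯_N`, `𝒯_N = 4 Γ_1 Γ_N |G_{1N}|²`, `|G_{1N}| = 1/|det Ẑ|` [Dhar2008 §3.2, §3.4.1];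
  this is (1.2)+(2.5) of [AH2011]: `det Z_n = v_nᵀ A_n⋯A_1 v_1` with `v_1 = e_1 + iλm_1ω e_2`,
  `v_n = e_1 - iλm_nω e_2`, and `λ²m_1m_nω²|det Z_n|^{-2} = |ṽ_nᵀQ_nṽ_1|^{-2}` with
  `ṽ_1 = (λm_1ω)^{-1/2}e_1 + i(λm_1ω)^{1/2}e_2`, i.e. `αM_1w ↔ λm_1ω`);
* three NAMED FACTS, the decomposition of `AjankiHuveneers2011_scaling` (provefact unit, SIZE XL):
  `CasherLebowitz1971_steadyState` (the Gaussian stationary measure: a weak steady state with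
  second moments `clCov`), `CasherLebowitz1971_currentFormula` (the left-bath power on that
  covariance, `λ(T_L - C_{p₁p₁}/m_1)`, equals `(T_L - T_R) · clSpectralConductance`), and
  `AjankiHuveneers2011_spectralScaling` (Theorem 1.1 in the form §6 of the paper proves it:
  `K n^{-3/2} ≤ E[clSpectralConductance] ≤ K' n^{-3/2}`);
* the PROVED reduction `AjankiHuveneers2011_scaling_of_spectral : steadyState → currentFormula →
  spectralScaling → AjankiHuveneers2011_scaling` (choice of the steady-state family, the masses are
  a.e. positive under `ρ^{⊗n}`, transport of integrability and of the two bounds).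

## Sources

* O. Ajanki, F. Huveneers, CMP 301 (2011) 841–883, arXiv:1003.1076: §1.1 (model, Thm 1.1), §1
  eq. (1.2), §2–§2.1 eqs. (2.2)–(2.7) (transfer matrices `A_k = [[2 - π²w²(1+B_k), -1],[1, 0]]`,
  `D_n(v)` recursion, `Q_n = A_n⋯A_1`, bath vectors (2.5), `J^CL_n ∼ (T_1-T_n)∫|v_{CL,n}ᵀQ_nv_{CL,1}|^{-2}
  ∼ ∫_0^∞ j_n =: J_n` (2.6)), §6 (proof: lower bound §6.1 from Prop. 5.1 + Lemma 6.1, upper bound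
  §6.2 `𝒥₁ + 𝒥₂ + 𝒥₃` from Prop. 5.1, Prop. 4.1 and "It has already been shown by O'Connor that
  `𝒥₃ ≲ e^{-Cn^{1/2}}`").
* A. Casher, J. L. Lebowitz, J. Math. Phys. 12 (1971) 1701–1711 (model, stationary Gaussian
  measure, transmission formula; not re-read — paywalled — cited as restated in AH2011 and Dhar2008).
* A. Dhar, Adv. Phys. 57 (2008) 457–537, arXiv:0808.3256: §3.1 (RLL method, arbitrary masses:
  `a·B + B·aᵀ = D`, Gaussian steady state, heat input `γ_l/m_l (T^B_l - ⟨p_l²/m_l⟩)` at a bath site),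
  §3.2 (`J = k_B ΔT/(4π) ∫ dω 𝒯(ω)`, `𝒯 = 4 Tr[G⁺Γ_L G⁻Γ_R]`, classical white-noise baths),
  §3.4.1 (mass-disordered chain: `𝒯_N = 4Γ²|G_{1N}|²`, `Ẑ = [-ω²M̂ + Φ̂ - Σ̂]`, `|G_{1N}| = 1/|Δ_N|`,
  `Δ_N` via products of `T̂_l = [[2 - m_lω², -1],[1, 0]]`).

## Design notes

* Friction in [AH2011 (1.4)] is `-λ p_k dt` with noise `√(2λT_k m_k) dW_k`, i.e. Dhar's
  `γ_l = λ m_l`; both baths act on the single site of a one-site chain (`bathMult`, `bathTemp` of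
  `HarmonicChainCovariance.lean`, as in `clGenerator`), and the walls `q_0 = q_{n+1} = 0` add
  `diag(bathMult)` to the free Laplacian `forceMatrix 0 n`, so `clForceMatrix` is positive definite
  without pinning.
* `clSpectralConductance` is `0` for the empty chain and carries Bochner junk if the frequency
  integral diverged (it converges for `n ≥ 1`, positive masses and `λ > 0`: the integrand is
  `O(ω^{2-4n})` and `det Z_n(ω) ≠ 0` for real `ω`); `clCov` carries the junk `0` of `lyapSol`
  outside `m > 0, λ > 0` (then `isHurwitz_clDriftMatrix` applies). The exact constant
  `λ² m_1 m_n/π` (integral over `ℝ`) was checked against the Lyapunov solution numerically for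
  `n = 1, …, 4` (pure-Python Lyapunov solve vs. quadrature, agreement to 6 digits for `n ≥ 2`,
  the `n = 1` tail decaying only like `ω^{-2}`) and by hand for `n = 1` (`λ(T_L - T_R)/2` on both
  sides: `∫_ℝ ω² dω/((2 - mω²)² + 4λ²m²ω²) = π/(2λm²)`).
* The facts quantify over ALL `n` and positive masses (no randomness): (F1a)+(F1b) say that the
  Casher–Lebowitz current `J^CL_n(m_1,…,m_n)` of [AH2011 §1.1] is `(T_L - T_R)·clSpectralConductance m λ`
  along a weak steady state, which is all the SDE content Theorem 1.1 needs; (F2) is the theorem's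
  analytic content. Discharging (F1a) is the Gaussian/Itô computation of [Dhar2008 §3.1] (cf. the
  unit-mass development in `HarmonicChainCovariance.lean`); (F1b) is the frequency-domain solution
  of the Lyapunov equation plus the tridiagonal cofactor identity; (F2) is §§3–6 of the paper
  (Prop. 3.1/Cor. 3.2 representation `D_n(e_1) ∼ w^{-1}Γ_n sin πX_n`, Prop. 4.1
  `E(1/Γ_n) ≲ e^{-αw²n}`, Prop. 5.1 potential theory, Lemma 6.1) and O'Connor 1975 Thm 6.
* NOT here: uniqueness of the weak steady state, Gaussianity as a measure-level statement, the
  Rubin–Greer model, Dhar's generalised baths (§6.3 of the paper).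
-/

noncomputable section

open MeasureTheory Matrix Filter

namespace Literature.Barriers.AtomisticToContinuum.HeatConduction

open Literature.MathematicalPhysics.KineticTheory.HeatConduction

/-! ### The matrices of the Casher–Lebowitz chain -/

section Matrices

variable {R : Type*} [CommRing R]

/-- The force matrix `Φ_D` of the Casher–Lebowitz chain with `n` sites and walls
`q_0 = q_{n+1} = 0`: the Hessian of `½∑_{k=0}^{n}(q_{k+1} - q_k)²`, i.e. the free nearest-neighbour
Laplacian `forceMatrix 0 n` plus the wall springs `diag([i = 0] + [i = n-1])` (tridiagonal,
diagonal `2`, off-diagonal `-1`; for `n = 1` the single entry is `2`). Over any commutative ring.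
[cite: AjankiHuveneers2011, §1.1 eq. (1.3)] -/
def clForceMatrix (n : ℕ) : Matrix (Fin n) (Fin n) R :=
  forceMatrix 0 n + Matrix.diagonal (bathMult n)

/-- The drift matrix `[[0, M⁻¹], [-Φ_D, -λE]]`, `E = diag([i=0] + [i=n-1])`, of the
Casher–Lebowitz dynamics `dq_k = (p_k/m_k) dt`, `dp_k = -∂_{q_k}H dt + (δ_{k,1}+δ_{k,n})(-λ p_k dt + …)`
on `ℝⁿ ⊕ ℝⁿ` (positions `inl`, momenta `inr`). [cite: AjankiHuveneers2011, §1.1 eq. (1.4)] -/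
def clDriftMatrix {n : ℕ} (m : Fin n → ℝ) (lam : ℝ) : Matrix (Fin n ⊕ Fin n) (Fin n ⊕ Fin n) ℝ :=
  Matrix.fromBlocks 0 (Matrix.diagonal fun i => (m i)⁻¹) (-clForceMatrix n) (-frictionMatrix lam n)

/-- The noise (diffusion) matrix `[[0, 0], [0, diag(2λ m_i ([i=0]T_L + [i=n-1]T_R))]]` of the
Casher–Lebowitz baths (`dp_k = … + √(2λT_k m_k) dW_k` at the two ends).
[cite: AjankiHuveneers2011, §1.1 eq. (1.4)] -/
def clNoiseMatrix {n : ℕ} (m : Fin n → ℝ) (lam T_L T_R : ℝ) :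
    Matrix (Fin n ⊕ Fin n) (Fin n ⊕ Fin n) ℝ :=
  Matrix.fromBlocks 0 0 0 (Matrix.diagonal fun i => 2 * lam * m i * bathTemp n T_L T_R i)

/-- THE stationary covariance `B = ⟨(q,p)(q,p)ᵀ⟩` of the Casher–Lebowitz chain with masses `m`,
friction `λ` and bath temperatures `T_L, T_R`: the solution of the Lyapunov equation
`A B + B Aᵀ + Σ = 0` (`lyapSol`; junk `0` unless the Lyapunov operator is bijective, which
`isHurwitz_clDriftMatrix` guarantees for `m > 0`, `λ > 0`). "The solution of this equation gives
the steady state correlation matrix which completely determines the steady state since we are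
dealing with a Gaussian process." [cite: Dhar2008, §3.1] -/
def clCov {n : ℕ} (m : Fin n → ℝ) (lam T_L T_R : ℝ) : Matrix (Fin n ⊕ Fin n) (Fin n ⊕ Fin n) ℝ :=
  lyapSol (clDriftMatrix m lam) (clNoiseMatrix m lam T_L T_R)

/-- The impedance matrix `Z_n(ω) = Φ_D - ω² M - iωλ M E` of the Casher–Lebowitz chain
(`Ẑ = -ω²M̂ + Φ̂ - Σ̂(ω)` with `Σ_{11} = Σ_{nn} = iγω`, `γ_l = λ m_l`; both self-energies on the
single site when `n = 1`). Its determinant is `v_nᵀ A_n(ω)⋯A_1(ω) v_1` with the transfer matrices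
`A_k = [[2 - m_kω², -1],[1,0]]`, `v_1 = e_1 + iλm_1ω e_2`, `v_n = e_1 - iλm_nω e_2`.
[cite: Dhar2008, §3.4.1] [cite: AjankiHuveneers2011, §2.1 eqs. (2.2)-(2.5)] -/
def clImpedance {n : ℕ} (m : Fin n → ℝ) (lam ω : ℝ) : Matrix (Fin n) (Fin n) ℂ :=
  clForceMatrix n -
    Matrix.diagonal fun i => (m i : ℂ) * (ω : ℂ) ^ 2 + Complex.I * ω * lam * m i * bathMult n i

/-- The transmission integral per unit temperature difference of the Casher–Lebowitz chain with
masses `m` and friction `λ`: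
`𝒢_n(m, λ) = (λ² m_1 m_n / π) ∫_ℝ ω² |det Z_n(ω)|^{-2} dω = (1/4π)∫_ℝ 𝒯_n(ω) dω`,
`𝒯_n = 4 Γ_1 Γ_n |G_{1n}|²`, `Γ_l = λ m_l ω`, `|G_{1n}| = 1/|det Z_n|`; equivalently
`(1/π)∫_ℝ |ṽ_nᵀ Q_n(ω) ṽ_1|^{-2} dω` with the Casher–Lebowitz bath vectors
`ṽ_1 = (λm_1ω)^{-1/2}e_1 + i(λm_1ω)^{1/2}e_2`, `ṽ_n = (λm_nω)^{-1/2}e_1 - i(λm_nω)^{1/2}e_2`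
(AH2011 (1.2), (2.5) with `αM_kw = λm_kω`). `0` for the empty chain; Bochner junk if the
integral diverged (it converges for `n ≥ 1`, `m > 0`, `λ > 0`).
[cite: Dhar2008, §3.2 and §3.4.1] [cite: AjankiHuveneers2011, §1 eq. (1.2) and §2.1 eq. (2.5)] -/
def clSpectralConductance : {n : ℕ} → (Fin n → ℝ) → ℝ → ℝ
  | 0, _, _ => 0
  | k + 1, m, lam => lam ^ 2 * m 0 * m (Fin.last k) / Real.pi *
      ∫ ω : ℝ, ω ^ 2 / Complex.normSq (clImpedance m lam ω).det

/-- The left-bath power evaluated on the stationary covariance: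
`λ (T_L - B_{p₁p₁}/m_1)` ("`γ_l/m_l (T^B_l - T_l)`, `T_l = ⟨p_l²/m_l⟩` … the heat input at this
site"), written as a sum over `k.val = 0` like `clLeftFlux`. [cite: Dhar2008, §3.1] -/
def clCovFlux {n : ℕ} (m : Fin n → ℝ) (lam T_L T_R : ℝ) : ℝ :=
  ∑ k : Fin n, if k.val = 0 then lam * (T_L - clCov m lam T_L T_R (Sum.inr k) (Sum.inr k) / m k)
    else 0

/-- The linear coordinates on phase space indexed by `Fin n ⊕ Fin n`: `inl i ↦ q_i`,
`inr i ↦ p_i`. [folklore] -/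
def phaseCoord {n : ℕ} : Fin n ⊕ Fin n → PhaseSpace n → ℝ :=
  Sum.elim (fun i x => x.1 i) (fun i x => x.2 i)

/-! ### Closed forms -/

/-- A row of `Φ_D u`: the free-Laplacian row plus the wall term. [folklore] -/
theorem clForceMatrix_mulVec_apply {n : ℕ} (u : Fin n → R) (a : Fin n) :
    (clForceMatrix n *ᵥ u) a = (forceMatrix 0 n *ᵥ u) a + bathMult n a * u a := by
  simp only [clForceMatrix, add_mulVec, Pi.add_apply, mulVec_diagonal]

/-- **Propagation along the chain.** If `u` solves the rows `a = 0, …, n-2` of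
`Φ_D u + κ u = 0` for some site-dependent coefficients `κ` and vanishes at the left end, then
`u = 0` (row `a` determines `u_{a+1}` from `u_a, u_{a-1}`). [folklore] -/
theorem cl_chain_propagation {n : ℕ} (κ u : Fin n → R)
    (hrow : ∀ a : Fin n, a.val + 1 < n → (clForceMatrix n *ᵥ u) a + κ a * u a = 0)
    (h0 : ∀ a : Fin n, a.val = 0 → u a = 0) : u = 0 := by
  suffices h : ∀ k : ℕ, ∀ a : Fin n, a.val ≤ k → u a = 0 by
    funext a
    exact h a.val a le_rfl
  intro k
  induction k with
  | zero =>
    intro a ha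
    exact h0 a (Nat.le_zero.mp ha)
  | succ k ih =>
    intro a ha
    rcases Nat.lt_or_ge a.val (k + 1) with hlt | hge
    · exact ih a (by omega)
    · have haeq : a.val = k + 1 := le_antisymm ha hge
      have hk : k + 1 < n := haeq ▸ a.isLt
      set a' : Fin n := ⟨k, by omega⟩ with ha'
      have hrow' := hrow a' (by simp [ha']; omega)
      rw [clForceMatrix_mulVec_apply, forceMatrix_mulVec_apply_eq] at hrow'
      have hu' : u a' = 0 := ih a' (by simp [ha'])
      have hprev : (if h : 0 < a'.val then u a' - u ⟨a'.val - 1, by omega⟩ else 0) = 0 := by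
        split_ifs with h
        · rw [hu', ih ⟨a'.val - 1, by omega⟩ (by simp [ha']), sub_zero]
        · rfl
      have hnext : (if h : a'.val + 1 < n then u ⟨a'.val + 1, h⟩ - u a' else 0) =
          u ⟨k + 1, hk⟩ := by
        rw [dif_pos (by simp [ha']; omega), hu', sub_zero]
      rw [hprev, hnext, hu'] at hrow'
      have : u ⟨k + 1, hk⟩ = 0 := by
        have h := hrow'
        simp only [mul_zero, zero_add, zero_sub, add_zero, neg_eq_zero] at h
        exact h
      have hae : a = ⟨k + 1, hk⟩ := Fin.ext haeq
      rw [hae]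
      exact this

end Matrices

/-! ### Stability: the drift matrix is Hurwitz -/

/-- Complexification of the Dirichlet force matrix. [folklore] -/
theorem clForceMatrix_map_ofReal (n : ℕ) :
    (clForceMatrix n : Matrix (Fin n) (Fin n) ℝ).map (algebraMap ℝ ℂ) = clForceMatrix n := by
  have h1 := forceMatrix_map_ofReal (0 : ℝ) n
  rw [Complex.ofReal_zero] at h1
  ext i j
  have h1' := congrFun (congrFun h1 i) j
  rw [Matrix.map_apply] at h1'
  rw [Matrix.map_apply, clForceMatrix, clForceMatrix, Matrix.add_apply, Matrix.add_apply, map_add,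
    h1', diagonal_apply, diagonal_apply]
  split_ifs with h
  · simp only [Complex.coe_algebraMap, bathMult_ofReal]
  · rw [map_zero]

/-- Complexification of the drift matrix. [folklore] -/
theorem clDriftMatrix_map_ofReal {n : ℕ} (m : Fin n → ℝ) (lam : ℝ) :
    (clDriftMatrix m lam).map (algebraMap ℝ ℂ) =
      Matrix.fromBlocks 0 (Matrix.diagonal fun i => ((m i : ℂ))⁻¹) (-clForceMatrix n)
        (-frictionMatrix (lam : ℂ) n) := by
  rw [clDriftMatrix, fromBlocks_map, ← frictionMatrix_map_ofReal, Matrix.map_zero _ (map_zero _),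
    Matrix.map_neg _ (map_neg _), Matrix.map_neg _ (map_neg _), clForceMatrix_map_ofReal,
    Matrix.diagonal_map (map_zero _)]
  congr 2
  ext i
  simp only [Complex.coe_algebraMap, Complex.ofReal_inv]

/-- The Hermitian form of the Dirichlet force matrix is real and non-negative:
`u⋆ Φ_D u = ∑_{l = k+1} |u_l - u_k|² + ∑ ([i=0]+[i=n-1]) |u_i|²`. [folklore] -/
theorem star_dotProduct_clForceMatrix_mulVec {n : ℕ} (u : Fin n → ℂ) :
    star u ⬝ᵥ (clForceMatrix n *ᵥ u) =
      ((∑ k : Fin n, ∑ l : Fin n, (if l.val = k.val + 1 then Complex.normSq (u l - u k) else 0)) +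
        ∑ i, bathMult n i * Complex.normSq (u i) : ℝ) := by
  have h1 := star_dotProduct_forceMatrix_mulVec_eq (0 : ℝ) u
  rw [Complex.ofReal_zero] at h1
  rw [clForceMatrix, add_mulVec, dotProduct_add, h1]
  push_cast
  simp only [zero_mul, zero_add, mulVec_diagonal, dotProduct, Pi.star_apply, Complex.star_def,
    Complex.normSq_eq_conj_mul_self, bathMult_ofReal]
  congr 1
  exact Finset.sum_congr rfl fun i _ => by ring

/-- **The drift matrix of the Casher–Lebowitz chain is Hurwitz** (`m > 0`, `λ > 0`, every `n`).
If `A(u, w) = μ(u, w)` then `w = μ M u` and `Φ_D u + μλ E M u + μ² M u = 0`; pairing with `u⋆`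
gives `c + bμ + aμ² = 0` with `a = ∑ m_i|u_i|² > 0`, `b = λ∑([i=0]+[i=n-1]) m_i|u_i|² ≥ 0`,
`c = u⋆Φ_D u ≥ 0`, whence `Re μ < 0` unless `b = 0` or `c = 0`; either of these forces `u_0 = 0`
and then `u = 0` by propagation along the chain (no undamped mode has a node at the bath site).
[folklore] -/
theorem isHurwitz_clDriftMatrix {n : ℕ} {m : Fin n → ℝ} (hm : ∀ k, 0 < m k) {lam : ℝ}
    (hlam : 0 < lam) : IsHurwitz (clDriftMatrix m lam) := by
  intro μ v hv h
  rw [clDriftMatrix_map_ofReal] at h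
  set u : Fin n → ℂ := fun i => v (Sum.inl i) with hu
  set w : Fin n → ℂ := fun i => v (Sum.inr i) with hw
  have hv_eq : v = Sum.elim u w := by
    ext i
    rcases i with i | i <;> rfl
  rw [hv_eq, fromBlocks_mulVec] at h
  simp only [Sum.elim_comp_inl, Sum.elim_comp_inr] at h
  have hm0 : ∀ i, (m i : ℂ) ≠ 0 := fun i => Complex.ofReal_ne_zero.mpr (hm i).ne'
  -- top rows: `w_i / m_i = μ u_i`
  have hl : ∀ i, w i = μ * m i * u i := by
    intro i
    have h1 := congrFun h (Sum.inl i)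
    simp only [zero_mulVec, zero_add, mulVec_diagonal, Sum.elim_inl, Pi.smul_apply,
      smul_eq_mul] at h1
    have h2 : w i = (m i : ℂ) * (μ * u i) := by
      rw [← h1, mul_inv_cancel_left₀ (hm0 i)]
    rw [h2]
    ring
  -- bottom rows: `-Φ_D u - λ E w = μ w`
  have hr : ∀ i, -(clForceMatrix n *ᵥ u) i - lam * bathMult n i * w i = μ * w i := by
    intro i
    have h1 := congrFun h (Sum.inr i)
    simpa [neg_mulVec, frictionMatrix, mulVec_diagonal, sub_eq_add_neg] using h1
  -- the vector equation `Φ_D u + κ u = 0`, `κ_i = λ E_i μ m_i + μ² m_i`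
  set κ : Fin n → ℂ := fun i => lam * bathMult n i * μ * m i + μ ^ 2 * m i with hκ
  have hvec : ∀ i, (clForceMatrix n *ᵥ u) i + κ i * u i = 0 := by
    intro i
    have h1 := hr i
    rw [hl i] at h1
    simp only [hκ]
    linear_combination -h1
  -- `u ≠ 0`
  have hu0 : u ≠ 0 := by
    intro h0
    apply hv
    rw [hv_eq]
    ext i
    rcases i with i | i
    · simp [h0]
    · simp only [Sum.elim_inr, Pi.zero_apply]
      rw [hl i, h0]
      simp
  have hnode : ¬ (∀ a : Fin n, a.val = 0 → u a = 0) := fun h0 =>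
    hu0 (cl_chain_propagation κ u (fun a _ => hvec a) h0)
  -- pairing with `u⋆`
  set aR : ℝ := ∑ i, m i * Complex.normSq (u i) with haR
  set bR : ℝ := lam * ∑ i, bathMult n i * (m i * Complex.normSq (u i)) with hbR
  set cR : ℝ := (∑ k : Fin n, ∑ l : Fin n,
      (if l.val = k.val + 1 then Complex.normSq (u l - u k) else 0)) +
    ∑ i, bathMult n i * Complex.normSq (u i) with hcR
  have haR_pos : 0 < aR := by
    obtain ⟨i, hi⟩ : ∃ i, u i ≠ 0 := by
      by_contra hall
      push Not at hall
      exact hu0 (funext hall)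
    exact lt_of_lt_of_le (mul_pos (hm i) (Complex.normSq_pos.mpr hi))
      (Finset.single_le_sum (f := fun i => m i * Complex.normSq (u i))
        (fun j _ => mul_nonneg (hm j).le (Complex.normSq_nonneg _)) (Finset.mem_univ i))
  have hbath_nn : ∀ i, 0 ≤ bathMult n i * (m i * Complex.normSq (u i)) := fun i =>
    mul_nonneg (bathMult_nonneg n i) (mul_nonneg (hm i).le (Complex.normSq_nonneg _))
  have hbR_nn : 0 ≤ bR := mul_nonneg hlam.le (Finset.sum_nonneg fun i _ => hbath_nn i)
  have hwall_nn : ∀ i, 0 ≤ bathMult n i * Complex.normSq (u i) := fun i =>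
    mul_nonneg (bathMult_nonneg n i) (Complex.normSq_nonneg _)
  have hbond_nn : 0 ≤ ∑ k : Fin n, ∑ l : Fin n,
      (if l.val = k.val + 1 then Complex.normSq (u l - u k) else 0) :=
    Finset.sum_nonneg fun k _ => Finset.sum_nonneg fun l _ => by
      split_ifs
      · exact Complex.normSq_nonneg _
      · exact le_rfl
  have hcR_nn : 0 ≤ cR := add_nonneg hbond_nn (Finset.sum_nonneg fun i _ => hwall_nn i)
  have hquad : (cR : ℂ) + μ * bR + μ ^ 2 * aR = 0 := by
    have hsum : ∑ i, star (u i) * ((clForceMatrix n *ᵥ u) i + κ i * u i) = 0 :=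
      Finset.sum_eq_zero fun i _ => by rw [hvec i, mul_zero]
    have e : ∑ i, star (u i) * ((clForceMatrix n *ᵥ u) i + κ i * u i) =
        star u ⬝ᵥ (clForceMatrix n *ᵥ u) +
          μ * (lam * ∑ i, bathMult n i * (m i * (star (u i) * u i))) +
          μ ^ 2 * ∑ i, m i * (star (u i) * u i) := by
      simp only [dotProduct, Pi.star_apply, Finset.mul_sum, ← Finset.sum_add_distrib, hκ]
      refine Finset.sum_congr rfl fun i _ => ?_
      ring
    rw [e, star_dotProduct_clForceMatrix_mulVec] at hsum
    have e2 : (cR : ℂ) + μ * bR + μ ^ 2 * aR =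
        (((∑ k : Fin n, ∑ l : Fin n, (if l.val = k.val + 1 then Complex.normSq (u l - u k) else 0)) +
            ∑ i, bathMult n i * Complex.normSq (u i) : ℝ) : ℂ) +
          μ * (lam * ∑ i, bathMult n i * (m i * (star (u i) * u i))) +
          μ ^ 2 * ∑ i, m i * (star (u i) * u i) := by
      simp only [haR, hbR, hcR]
      push_cast
      simp only [Complex.star_def, Complex.normSq_eq_conj_mul_self, bathMult_ofReal]
    rw [e2]
    exact hsum
  -- a vanishing wall sum puts a node at the left bath site
  have hwall : ∑ i, bathMult n i * Complex.normSq (u i) = 0 → False := by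
    intro hsum0
    apply hnode
    intro a ha
    have hterm := (Finset.sum_eq_zero_iff_of_nonneg fun i _ => hwall_nn i).mp hsum0 a
      (Finset.mem_univ a)
    have h1 := one_le_bathMult a ha
    rcases mul_eq_zero.mp hterm with h2 | h2
    · linarith
    · exact Complex.normSq_eq_zero.mp h2
  by_cases hc : 0 < cR
  · rcases re_neg_or_eq_zero_of_quadratic haR_pos hbR_nn hc hquad with hneg | hb0
    · exact hneg
    · exfalso
      apply hnode
      intro a ha
      have hsum0 : ∑ i, bathMult n i * (m i * Complex.normSq (u i)) = 0 := by
        have := hb0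
        simp only [hbR] at this
        rcases mul_eq_zero.mp this with h1 | h1
        · exact absurd h1 hlam.ne'
        · exact h1
      have hterm := (Finset.sum_eq_zero_iff_of_nonneg fun i _ => hbath_nn i).mp hsum0 a
        (Finset.mem_univ a)
      have h1 := one_le_bathMult a ha
      rcases mul_eq_zero.mp hterm with h2 | h2
      · linarith
      · rcases mul_eq_zero.mp h2 with h3 | h3
        · exact absurd h3 (hm a).ne'
        · exact Complex.normSq_eq_zero.mp h3
  · exfalso
    have hc0 : cR = 0 := le_antisymm (not_lt.mp hc) hcR_nn
    apply hwall
    have : (∑ k : Fin n, ∑ l : Fin n,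
        (if l.val = k.val + 1 then Complex.normSq (u l - u k) else 0)) +
        ∑ i, bathMult n i * Complex.normSq (u i) = 0 := hc0
    linarith [Finset.sum_nonneg fun i (_ : i ∈ Finset.univ) => hwall_nn i]

/-- The Lyapunov equation `A B + B Aᵀ + Σ = 0` of the stationary covariance (`m > 0`, `λ > 0`).
[cite: Dhar2008, §3.1] -/
theorem clCov_lyapunov {n : ℕ} {m : Fin n → ℝ} (hm : ∀ k, 0 < m k) {lam : ℝ} (hlam : 0 < lam)
    (T_L T_R : ℝ) :
    clDriftMatrix m lam * clCov m lam T_L T_R + clCov m lam T_L T_R * (clDriftMatrix m lam)ᵀ +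
      clNoiseMatrix m lam T_L T_R = 0 :=
  (isHurwitz_clDriftMatrix hm hlam).lyapSol_eq _

/-- Uniqueness: the stationary covariance is the only solution of its Lyapunov equation
(`m > 0`, `λ > 0`). [folklore] -/
theorem eq_clCov {n : ℕ} {m : Fin n → ℝ} (hm : ∀ k, 0 < m k) {lam : ℝ} (hlam : 0 < lam)
    {T_L T_R : ℝ} {X : Matrix (Fin n ⊕ Fin n) (Fin n ⊕ Fin n) ℝ}
    (hX : clDriftMatrix m lam * X + X * (clDriftMatrix m lam)ᵀ + clNoiseMatrix m lam T_L T_R = 0) :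
    X = clCov m lam T_L T_R :=
  (isHurwitz_clDriftMatrix hm hlam).eq_lyapSol hX

/-! ### From second moments to the left-bath power -/

/-- In a weak steady state whose second moments are the stationary covariance, the mean power
injected by the left bath is `λ(T_L - B_{p₁p₁}/m_1)`. [cite: Dhar2008, §3.1] -/
theorem clLeftFlux_eq_clCovFlux {n : ℕ} {m : Fin n → ℝ} {lam T_L T_R : ℝ}
    {μ : Measure (PhaseSpace n)} (hst : clIsSteadyState m lam T_L T_R μ)
    (hmom : ∀ i j : Fin n ⊕ Fin n,
      Integrable (fun x => phaseCoord i x * phaseCoord j x) μ ∧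
        ∫ x, phaseCoord i x * phaseCoord j x ∂μ = clCov m lam T_L T_R i j) :
    clLeftFlux m lam T_L μ = clCovFlux m lam T_L T_R := by
  obtain ⟨hprob, -, hint⟩ := hst
  unfold clLeftFlux clCovFlux
  refine Finset.sum_congr rfl fun k _ => ?_
  split_ifs with hk
  · have h2 : ∫ x, x.2 k ^ 2 ∂μ = clCov m lam T_L T_R (Sum.inr k) (Sum.inr k) := by
      rw [← (hmom (Sum.inr k) (Sum.inr k)).2]
      refine integral_congr_ae (ae_of_all _ fun x => ?_)
      simp [phaseCoord, sq]
    rw [integral_const_mul, integral_sub (integrable_const _) ((hint k).div_const _),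
      integral_div, h2, integral_const]
    simp
  · rfl

end Literature.Barriers.AtomisticToContinuum.HeatConduction

namespace Literature.Barriers.AtomisticToContinuum

open Literature.MathematicalPhysics.KineticTheory.HeatConduction HeatConduction

/-! ### The three named facts -/

/-- **(F1a) The Gaussian stationary state of the Casher–Lebowitz chain** (Rieder–Lebowitz–Lieb
1967 for equal masses; Casher–Lebowitz 1971, §2; Dhar 2008, §3.1 for arbitrary masses `m_l` and
couplings `γ_l`): for every `n`, positive masses, `λ > 0` and `T_L, T_R > 0`, the linear SDE
(1.4) of AH2011 has a stationary probability measure — the centred Gaussian whose covariance `B`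
solves "`a·B + B·aᵀ = D`", here `clCov m λ T_L T_R` — which in particular is a weak steady state
of `clGenerator` (`clIsSteadyState`: `∫ L f dμ = 0` for `f ∈ C_c^∞`, `p_k²` integrable) with
second moments `∫ x_i x_j dμ = B_{ij}`. Vendored as the existence of such a weak steady state
(Gaussianity and uniqueness are printed but not asserted). Discharge = Itô/Gaussian integration
by parts, cf. the unit-mass `HarmonicChainCovariance.lean`.
[cite: Dhar2008, §3.1] [cite: CasherLebowitz1971, stationary Gaussian measure of the chain, as restated in AjankiHuveneers2011 §1.1 and Dhar2008 §3.1] [cite: RiederLebowitzLieb1967, Gaussian stationary state for equal masses, as restated in Dhar2008 §3.1 and §3.3] -/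
def CasherLebowitz1971_steadyState : Prop :=
  ∀ (n : ℕ) (m : Fin n → ℝ), (∀ k, 0 < m k) → ∀ lam T_L T_R : ℝ, 0 < lam → 0 < T_L → 0 < T_R →
    ∃ μ : Measure (PhaseSpace n), clIsSteadyState m lam T_L T_R μ ∧
      ∀ i j : Fin n ⊕ Fin n,
        Integrable (fun x => phaseCoord i x * phaseCoord j x) μ ∧
          ∫ x, phaseCoord i x * phaseCoord j x ∂μ = clCov m lam T_L T_R i j

/-- **(F1b) The Casher–Lebowitz transmission formula for the stationary current** (Casher–Lebowitz
1971; Dhar 2008 §3.2 `J = k_B(T_L - T_R)/(4π) ∫ dω 𝒯(ω)`, `𝒯 = 4Tr[G⁺Γ_LG⁻Γ_R]`, §3.4.1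
`𝒯_N = 4Γ²|G_{1N}|²`, `|G_{1N}| = 1/|det Ẑ|`; AH2011 (1.2) with the bath vectors (2.5)): for
positive masses, `λ > 0` and `T_L, T_R > 0`, the heat input of the left bath in the stationary
state, `λ(T_L - B_{p₁p₁}/m_1)` (`clCovFlux`), equals `(T_L - T_R) · clSpectralConductance m λ`,
`clSpectralConductance m λ = (λ²m_1m_n/π)∫_ℝ ω²|det Z_n(ω)|^{-2} dω`. (Frequency-domain solution
of the Lyapunov equation plus the cofactor identity `(Z⁻¹)_{1n} = 1/det Z` for the tridiagonal
`Z`; constant checked for `n = 1,…,4`, see the module docstring.)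
[cite: Dhar2008, §3.2 and §3.4.1] [cite: CasherLebowitz1971, transmission formula as restated in AjankiHuveneers2011 eqs. (1.2), (2.5)] [cite: AjankiHuveneers2011, §1 eq. (1.2) and §2.1 eqs. (2.3)-(2.6)] -/
def CasherLebowitz1971_currentFormula : Prop :=
  ∀ (n : ℕ) (m : Fin n → ℝ), (∀ k, 0 < m k) → ∀ lam : ℝ, 0 < lam → ∀ T_L T_R : ℝ,
    0 < T_L → 0 < T_R →
      clCovFlux m lam T_L T_R = (T_L - T_R) * clSpectralConductance m lam

/-- **(F2) Ajanki–Huveneers 2011, Theorem 1.1, in the transmission-integral form in which it is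
proved** (§2.1 (2.6)–(2.7) and §6; the high-frequency part of the upper bound from O'Connor 1975,
Thm 6): if the masses are i.i.d. with a density `τ` vanishing off `[a, b] ⊂ (0, ∞)`, continuous on
`[a, b]`, `C¹` with bounded derivative on `(a, b)` (the §2 form of the hypothesis of Thm 1.1), then
for every friction `λ > 0` there are `K, K' > 0` (depending on `τ` and `λ` only) such that for all
large `n` the mass average of the transmission integral obeys
`K n^{-3/2} ≤ E[clSpectralConductance (M_1,…,M_n) λ] ≤ K' n^{-3/2}` (and is an honest expectation:
integrable). With (F1a)–(F1b) this is literally Theorem 1.1 (`E J^CL_n = (T_1 - T_n) E[𝒢_n]`);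
see `AjankiHuveneers2011_scaling_of_spectral`. The paper asserts the bounds for all `n`.
[cite: AjankiHuveneers2011, Thm 1.1 with §2.1 eqs. (2.5)-(2.7) and §6] -/
def AjankiHuveneers2011_spectralScaling : Prop :=
  ∀ (τ : ℝ → ℝ) (a b : ℝ), 0 < a → a < b → (∀ s, 0 ≤ τ s) → (∀ s ∉ Set.Icc a b, τ s = 0) →
    ContinuousOn τ (Set.Icc a b) → ContDiffOn ℝ 1 τ (Set.Ioo a b) →
    (∃ C : ℝ, ∀ s ∈ Set.Ioo a b, |deriv τ s| ≤ C) → ∫ s, τ s = 1 →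
    ∀ (ρ : Measure ℝ) [IsProbabilityMeasure ρ],
      ρ = volume.withDensity (fun s => ENNReal.ofReal (τ s)) →
      ∀ lam : ℝ, 0 < lam →
        ∃ K K' : ℝ, 0 < K ∧ 0 < K' ∧ ∃ n₀ : ℕ, ∀ n : ℕ, n₀ ≤ n →
          Integrable (fun m : Fin n → ℝ => clSpectralConductance m lam)
              (Measure.pi fun _ : Fin n => ρ) ∧
            K / (n : ℝ) ^ (3 / 2 : ℝ) ≤
                ∫ m, clSpectralConductance m lam ∂(Measure.pi fun _ : Fin n => ρ) ∧
              ∫ m, clSpectralConductance m lam ∂(Measure.pi fun _ : Fin n => ρ) ≤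
                K' / (n : ℝ) ^ (3 / 2 : ℝ)

/-! ### The reduction -/

/-- Under (F1a) and (F1b), along the steady state they provide the Casher–Lebowitz current of the
chain with fixed positive masses is `(T_L - T_R) · 𝒢_n(m, λ)` ("The resulting current, denoted by
`J^CL_n(m_1,…,m_n)`, is then by definition the average rate at which energy is carried from the
left to the right heat bath over the stationary measure … for fixed masses").
[cite: AjankiHuveneers2011, §1.1 and eq. (1.2)] -/
theorem exists_clIsSteadyState_clLeftFlux_eq (hA : CasherLebowitz1971_steadyState)
    (hB : CasherLebowitz1971_currentFormula) {n : ℕ} (m : Fin n → ℝ) (hm : ∀ k, 0 < m k)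
    {lam T_L T_R : ℝ} (hlam : 0 < lam) (hL : 0 < T_L) (hR : 0 < T_R) :
    ∃ μ : Measure (PhaseSpace n), clIsSteadyState m lam T_L T_R μ ∧
      clLeftFlux m lam T_L μ = (T_L - T_R) * clSpectralConductance m lam := by
  obtain ⟨μ, hst, hmom⟩ := hA n m hm lam T_L T_R hlam hL hR
  exact ⟨μ, hst, by rw [clLeftFlux_eq_clCovFlux hst hmom, hB n m hm lam hlam T_L T_R hL hR]⟩

/-- **Reduction of `AjankiHuveneers2011_scaling` to its printed ingredients.** The SDE-side
fact follows from (F1a) the Gaussian steady state, (F1b) the Casher–Lebowitz transmission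
formula and (F2) the transmission-integral form of Theorem 1.1: choose for every mass vector the
steady state of (F1a) (junk `0` at non-positive masses, a `ρ^{⊗n}`-null set since `τ` vanishes off
`[a,b] ⊂ (0,∞)`), so that the flux is a.e. `(T_L - T_R)·𝒢_n`, and transport integrability and
the two bounds of (F2). [cite: AjankiHuveneers2011, Thm 1.1 and §2.1 eq. (2.6)] -/
theorem AjankiHuveneers2011_scaling_of_spectral (hA : CasherLebowitz1971_steadyState)
    (hB : CasherLebowitz1971_currentFormula) (hC : AjankiHuveneers2011_spectralScaling) :
    AjankiHuveneers2011_scaling := by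
  intro τ a b ha hab h0 hoff hcont hdiff hbd hint ρ hprob hρ lam T_L T_R hlam hR hLR
  have hL : 0 < T_L := hR.trans_le hLR
  obtain ⟨K, K', hK, hK', n₀, hn⟩ :=
    hC τ a b ha hab h0 hoff hcont hdiff hbd hint ρ hρ lam hlam
  refine ⟨K, K', hK, hK', n₀, fun n hn₀ => ?_⟩
  obtain ⟨hInt, hlo, hhi⟩ := hn n hn₀
  classical
  -- the steady-state family of (F1a)+(F1b), junk `0` at non-positive masses
  have hex : ∀ m : Fin n → ℝ, (∀ k, 0 < m k) →
      ∃ μ : Measure (PhaseSpace n), clIsSteadyState m lam T_L T_R μ ∧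
        clLeftFlux m lam T_L μ = (T_L - T_R) * clSpectralConductance m lam :=
    fun m hm => exists_clIsSteadyState_clLeftFlux_eq hA hB m hm hlam hL hR
  let μ : (Fin n → ℝ) → Measure (PhaseSpace n) := fun m =>
    if hm : ∀ k, 0 < m k then (hex m hm).choose else 0
  have hμ : ∀ m : Fin n → ℝ, (hm : ∀ k, 0 < m k) →
      clIsSteadyState m lam T_L T_R (μ m) ∧
        clLeftFlux m lam T_L (μ m) = (T_L - T_R) * clSpectralConductance m lam := by
    intro m hm
    have h := (hex m hm).choose_spec
    simp only [μ, dif_pos hm]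
    exact h
  -- the masses are a.e. positive
  have hρ0 : ρ (Set.Iic 0) = 0 := by
    rw [hρ, withDensity_apply _ measurableSet_Iic]
    have : ∀ s ∈ Set.Iic (0 : ℝ), ENNReal.ofReal (τ s) = 0 := by
      intro s hs
      have hs0 : s ≤ 0 := hs
      have hs' : s ∉ Set.Icc a b := fun h => absurd (ha.trans_le h.1) (not_lt.mpr hs0)
      rw [hoff s hs', ENNReal.ofReal_zero]
    rw [setLIntegral_congr_fun measurableSet_Iic this, lintegral_zero]
  have hae1 : ∀ᵐ s ∂ρ, 0 < s := by
    rw [ae_iff]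
    have hset : {s : ℝ | ¬ 0 < s} = Set.Iic 0 := by
      ext s
      simp
    rw [hset]
    exact hρ0
  have hae : ∀ᵐ m ∂(Measure.pi fun _ : Fin n => ρ), ∀ k, 0 < m k := by
    rw [ae_all_iff]
    intro k
    exact (measurePreserving_eval (fun _ : Fin n => ρ) k).quasiMeasurePreserving.ae hae1
  have hflux : (fun m => clLeftFlux m lam T_L (μ m)) =ᵐ[Measure.pi fun _ : Fin n => ρ]
      fun m => (T_L - T_R) * clSpectralConductance m lam :=
    hae.mono fun m hm => (hμ m hm).2
  have hδ : 0 ≤ T_L - T_R := sub_nonneg.mpr hLR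
  refine ⟨μ, fun m hm => (hμ m hm).1, (hInt.const_mul (T_L - T_R)).congr hflux.symm, ?_, ?_⟩
  · rw [integral_congr_ae hflux, integral_const_mul]
    calc K * (T_L - T_R) / (n : ℝ) ^ (3 / 2 : ℝ) = (T_L - T_R) * (K / (n : ℝ) ^ (3 / 2 : ℝ)) := by
          ring
      _ ≤ (T_L - T_R) * ∫ m, clSpectralConductance m lam ∂(Measure.pi fun _ : Fin n => ρ) :=
          mul_le_mul_of_nonneg_left hlo hδ
  · rw [integral_congr_ae hflux, integral_const_mul]
    calc (T_L - T_R) * ∫ m, clSpectralConductance m lam ∂(Measure.pi fun _ : Fin n => ρ)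
        ≤ (T_L - T_R) * (K' / (n : ℝ) ^ (3 / 2 : ℝ)) := mul_le_mul_of_nonneg_left hhi hδ
      _ = K' * (T_L - T_R) / (n : ℝ) ^ (3 / 2 : ℝ) := by ring

end Literature.Barriers.AtomisticToContinuum

end
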